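import Mathlib
import Summits.FinalStateConjecture.FinalStateConjecture.Theorems.PhotonSphereChannelsFarPotential
import Literature.Analysis.ODE.InverseSquareTailPolyChain
import Literature.Analysis.PDE.Wave1DPolynomialSolutions

/-!
# Route PhotonSphereChannels — the TRUE `t`-polynomial kernel of the Regge–Wheeler equation at the far end

Helper file for the FAR half of `FixedModeChannels` (stmt-FinalStateConjecture-10048). For the
spin-`s` Regge–Wheeler potential `V(x) = (1 − 2M/r)(ℓ(ℓ+1)/r² + (1 − s²)2M/r³)` of ANY tortoise
radius function `r` of the route's items (`2M < r`, `r' = 1 − 2M/r`, `r xc = 3M`) and every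
`N ≤ ℓ`, `farKernel_tPolynomial` produces a `t`-polynomial `C²` solution

  `p(t, x) = Σ_{m ≤ N/2} C_m(x) t^{N−2m}`

of `ψ_tt − ψ_xx + Vψ = 0` on the far half-strip `{x > x₀ + X_far}` (`x₀ = xc − r*(3M)`,
`X_far = X_far(M, ℓ)` explicit below), whose coefficient functions are asymptotic monomials of the
tortoise variable `y = x − x₀`:

  `C_m(x) = κ_m y^{2m−ℓ} + O(y^{2m−ℓ−1/2})`,  `C_m'(x) = κ_m(2m−ℓ) y^{2m−ℓ−1} + O(y^{2m−ℓ−3/2})`,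
  `κ_0 = 1`,  `κ_m · 2m(2ℓ−2m+1) = −(N−2m+2)(N−2m+1) κ_{m−1}`,  `κ_m ≠ 0`,

together with the item-vocabulary facts: `IsSol` in `iteratedDeriv` form, joint `C²`, the polynomial
representation `Σ_{i<Np} a_i(x) tⁱ`, the Cauchy data at `t = 0` (`(C_{N/2}, 0)` for even `N`,
`(0, C_{N/2})` for odd `N`) and crude size bounds `|C_m| ≤ K₂ y^{2m−ℓ}`, `|C_m'| ≤ K₂ y^{2m−ℓ−1}` for
the decay of the channel energies. These are exactly the `ℓ + 1` true kernel directions replacing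
the Kenig–Lawrie–Liu–Schlag data `r^{2k−d}` (`d = 2ℓ+3`, RW form `y^{2k−ℓ−2}`) of the exact
inverse-square problem, up to relative `O(y^{-1/2})` in the energy norm of `(R, ∞)`.
Ingredients: `abs_rwPotential_tortoise_sub_inverseSquare_le` (the far perturbation is
`O(ℓ²M log y/y³) ⊂ O(1/(y²√y))`), the ODE chain `Literature.Analysis.ODE.exists_polyChain_inverseSquareTail'`
(recessive solution by a Volterra contraction, descent by variation of parameters) and
`Literature.Analysis.PDE.exists_tPolynomial_waveSolution`.
-/

noncomputable section

namespace Summit.FinalStateConjecture.FinalStateConjecture.Theorems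

open Literature.Barriers.FinalStateConjecture Literature.Analysis.ODE Literature.Analysis.PDE Real Set

variable {M : ℝ} {r : ℝ → ℝ} {xc : ℝ}

/-- `1 + log y ≤ 2√y` for `y ≥ 1`. -/
theorem one_add_log_le_two_mul_sqrt {y : ℝ} (hy : 1 ≤ y) : 1 + Real.log y ≤ 2 * Real.sqrt y := by
  have hy0 : 0 < y := lt_of_lt_of_le one_pos hy
  have h1 : Real.log y = 2 * Real.log (Real.sqrt y) := by
    rw [Real.log_sqrt hy0.le]; ring
  have h2 := Real.log_le_sub_one_of_pos (Real.sqrt_pos.mpr hy0)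
  have h3 : 1 ≤ Real.sqrt y := by simpa using Real.sqrt_le_sqrt hy
  linarith

/-- **The far perturbation is `O(1/(y²√y))`.** With `x₀ = xc − efTortoiseCoord M (3M)` and
`y = x − x₀ ≥ 64M² + 2M + 1` (`s ≤ 2`):
`|V_{s,ℓ}(r x) − ℓ(ℓ+1)/y²| ≤ 32 M (ℓ(ℓ+1)+3)/(y²√y)`. -/
theorem abs_rwPotential_tortoise_sub_inverseSquare_le_sqrt (hM : 0 < M) (hr : ∀ x, 2 * M < r x)
    (hr' : ∀ x, HasDerivAt r (1 - 2 * M / r x) x) (hxc : r xc = 3 * M) {s : ℕ} (hs : s ≤ 2)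
    (ℓ : ℕ) {x : ℝ} (hx : 64 * M ^ 2 + 2 * M + 1 ≤ x - (xc - efTortoiseCoord M (3 * M))) :
    |(1 - 2 * M / r x) * ((ℓ : ℝ) * ((ℓ : ℝ) + 1) / r x ^ 2 + (1 - (s : ℝ) ^ 2) * (2 * M) / r x ^ 3)
        - (ℓ : ℝ) * ((ℓ : ℝ) + 1) / (x - (xc - efTortoiseCoord M (3 * M))) ^ 2|
      ≤ 32 * M * ((ℓ : ℝ) * ((ℓ : ℝ) + 1) + 3)
          / ((x - (xc - efTortoiseCoord M (3 * M))) ^ 2 * Real.sqrt (x - (xc - efTortoiseCoord M (3 * M)))) := by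
  set y := x - (xc - efTortoiseCoord M (3 * M)) with hy
  have hy1 : 1 ≤ y := by nlinarith
  have hy0 : 0 < y := lt_of_lt_of_le one_pos hy1
  have hs0 : 0 < Real.sqrt y := Real.sqrt_pos.2 hy0
  refine (abs_rwPotential_tortoise_sub_inverseSquare_le hM hr hr' hxc hs ℓ hx).trans ?_
  have hL : 0 ≤ 16 * M * ((ℓ : ℝ) * ((ℓ : ℝ) + 1) + 3) := by positivity
  calc 16 * M * ((ℓ : ℝ) * ((ℓ : ℝ) + 1) + 3) * (1 + Real.log y) / y ^ 3
      ≤ 16 * M * ((ℓ : ℝ) * ((ℓ : ℝ) + 1) + 3) * (2 * Real.sqrt y) / y ^ 3 := by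
        gcongr; exact one_add_log_le_two_mul_sqrt hy1
    _ = 32 * M * ((ℓ : ℝ) * ((ℓ : ℝ) + 1) + 3) / (y ^ 2 * Real.sqrt y) := by
        have hsq : Real.sqrt y * Real.sqrt y = y := Real.mul_self_sqrt hy0.le
        field_simp
        nlinarith [hsq]

/-- **The true far `t`-polynomial kernel.** See the module docstring. `x₀ = xc − efTortoiseCoord M (3M)`,
`X = 64M² + 2M + 1 + 144·(32M(ℓ(ℓ+1)+3))²`; everything is stated on the half-strip / half-line
`x > x₀ + X` in the item's coordinate `x` (tortoise variable `y = x − x₀`). -/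
theorem farKernel_tPolynomial (hM : 0 < M) (hr : ∀ x, 2 * M < r x)
    (hr' : ∀ x, HasDerivAt r (1 - 2 * M / r x) x) (hxc : r xc = 3 * M) {s : ℕ} (hs : s ≤ 2)
    (ℓ N : ℕ) (hN : N ≤ ℓ) :
    let x₀ : ℝ := xc - efTortoiseCoord M (3 * M)
    let X : ℝ := 64 * M ^ 2 + 2 * M + 1 + 144 * (32 * M * ((ℓ : ℝ) * ((ℓ : ℝ) + 1) + 3)) ^ 2
    let V : ℝ → ℝ := fun x => (1 - 2 * M / r x) * ((ℓ : ℝ) * ((ℓ : ℝ) + 1) / r x ^ 2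
      + (1 - (s : ℝ) ^ 2) * (2 * M) / r x ^ 3)
    ∃ (p : ℝ → ℝ → ℝ) (C : ℕ → ℝ → ℝ) (κ : ℕ → ℝ) (K K₂ : ℝ),
      (∀ t x, p t x = ∑ m ∈ Finset.range (N / 2 + 1), C m x * t ^ (N - 2 * m))
      ∧ ContDiffOn ℝ 2 (Function.uncurry p) (Set.univ ×ˢ Ioi (x₀ + X))
      ∧ (∀ t x, x₀ + X < x →
          iteratedDeriv 2 (fun τ => p τ x) t - iteratedDeriv 2 (p t) x + V x * p t x = 0)
      ∧ (∃ (Np : ℕ) (a : ℕ → ℝ → ℝ), ∀ t x, p t x = ∑ i ∈ Finset.range Np, a i x * t ^ i)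
      ∧ (Even N → ∀ x, p 0 x = C (N / 2) x ∧ deriv (fun τ => p τ x) 0 = 0)
      ∧ (¬ Even N → ∀ x, p 0 x = 0 ∧ deriv (fun τ => p τ x) 0 = C (N / 2) x)
      ∧ κ 0 = 1
      ∧ (∀ m, 1 ≤ m → 2 * m ≤ N →
          κ m * (2 * m * (2 * ℓ - 2 * m + 1)) = -(((N : ℝ) - 2 * m + 2) * ((N : ℝ) - 2 * m + 1)) * κ (m - 1))
      ∧ (∀ m, 2 * m ≤ N → κ m ≠ 0)
      ∧ (∀ m, 2 * m ≤ N →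
          ContDiffOn ℝ 2 (C m) (Ioi (x₀ + X))
          ∧ (∀ x, x₀ + X < x →
              |C m x - κ m * (x - x₀) ^ (2 * (m : ℝ) - ℓ)| ≤ K * (x - x₀) ^ (2 * (m : ℝ) - ℓ - 1 / 2))
          ∧ (∀ x, x₀ + X < x →
              |deriv (C m) x - κ m * (2 * (m : ℝ) - ℓ) * (x - x₀) ^ (2 * (m : ℝ) - ℓ - 1)|
                ≤ K * (x - x₀) ^ (2 * (m : ℝ) - ℓ - 1 - 1 / 2))
          ∧ (∀ x, x₀ + X < x → |C m x| ≤ K₂ * (x - x₀) ^ (2 * (m : ℝ) - ℓ))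
          ∧ (∀ x, x₀ + X < x → |deriv (C m) x| ≤ K₂ * (x - x₀) ^ (2 * (m : ℝ) - ℓ - 1))) := by
  intro x₀ X V
  set L : ℝ := (ℓ : ℝ) * ((ℓ : ℝ) + 1) with hL
  set A : ℝ := 32 * M * (L + 3) with hA
  have hA0 : 0 ≤ A := by positivity
  have hX1 : 1 ≤ X := by
    show (1 : ℝ) ≤ 64 * M ^ 2 + 2 * M + 1 + 144 * (32 * M * ((ℓ : ℝ) * ((ℓ : ℝ) + 1) + 3)) ^ 2
    nlinarith [sq_nonneg M, sq_nonneg (32 * M * ((ℓ : ℝ) * ((ℓ : ℝ) + 1) + 3))]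
  have hX0 : 0 < X := lt_of_lt_of_le one_pos hX1
  have hXY : ∀ y, X ≤ y → 64 * M ^ 2 + 2 * M + 1 ≤ y := by
    intro y hy
    have : 64 * M ^ 2 + 2 * M + 1 ≤ X := by
      show 64 * M ^ 2 + 2 * M + 1 ≤ 64 * M ^ 2 + 2 * M + 1 + 144 * (32 * M * ((ℓ : ℝ) * ((ℓ : ℝ) + 1) + 3)) ^ 2
      nlinarith [sq_nonneg (32 * M * ((ℓ : ℝ) * ((ℓ : ℝ) + 1) + 3))]
    linarith
  have hAX : 12 * A ≤ Real.sqrt X := by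
    have h1 : (12 * A) ^ 2 ≤ X := by
      show (12 * A) ^ 2 ≤ 64 * M ^ 2 + 2 * M + 1 + 144 * (32 * M * ((ℓ : ℝ) * ((ℓ : ℝ) + 1) + 3)) ^ 2
      rw [hA, hL]; nlinarith [sq_nonneg M]
    calc 12 * A = Real.sqrt ((12 * A) ^ 2) := by rw [Real.sqrt_sq (by positivity)]
      _ ≤ Real.sqrt X := Real.sqrt_le_sqrt h1
  -- the potential in the tortoise variable `y = x − x₀` and its perturbation `W`
  have hrc : Continuous r := continuous_iff_continuousAt.2 fun x => (hr' x).continuousAt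
  have hr0 : ∀ x, r x ≠ 0 := fun x => (lt_trans (by positivity) (hr x)).ne'
  have hVc : Continuous V := by
    show Continuous fun x => (1 - 2 * M / r x) * ((ℓ : ℝ) * ((ℓ : ℝ) + 1) / r x ^ 2
      + (1 - (s : ℝ) ^ 2) * (2 * M) / r x ^ 3)
    exact (continuous_const.sub (continuous_const.div hrc hr0)).mul
      ((continuous_const.div (hrc.pow 2) fun x => pow_ne_zero 2 (hr0 x)).add
        (continuous_const.div (hrc.pow 3) fun x => pow_ne_zero 3 (hr0 x)))
  set W : ℝ → ℝ := fun y => V (y + x₀) - L / y ^ 2 with hW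
  have hWc : ContinuousOn W (Ici X) := by
    refine ((hVc.comp (continuous_id.add continuous_const)).continuousOn).sub ?_
    exact continuousOn_const.div (continuousOn_id.pow 2) fun y hy => pow_ne_zero _ (hX0.trans_le hy).ne'
  have hWA : ∀ y, X ≤ y → |W y| ≤ A / (y ^ 2 * Real.sqrt y) := by
    intro y hy
    have hy' : 64 * M ^ 2 + 2 * M + 1 ≤ (y + x₀) - (xc - efTortoiseCoord M (3 * M)) := by
      show 64 * M ^ 2 + 2 * M + 1 ≤ (y + (xc - efTortoiseCoord M (3 * M))) - (xc - efTortoiseCoord M (3 * M))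
      rw [add_sub_cancel_right]; exact hXY y hy
    have h := abs_rwPotential_tortoise_sub_inverseSquare_le_sqrt hM hr hr' hxc hs ℓ hy'
    have e : (y + x₀) - (xc - efTortoiseCoord M (3 * M)) = y := by
      show (y + (xc - efTortoiseCoord M (3 * M))) - (xc - efTortoiseCoord M (3 * M)) = y; ring
    rw [e] at h
    exact h
  have hVW : ∀ y, y ≠ 0 → L / y ^ 2 + W y = V (y + x₀) := fun y _ => by simp only [hW]; ring
  -- the ODE chain in the variable `y`
  obtain ⟨c, c', κ, K, K₂, hκ0, hκ, hκne, hlev, hode0, hode, -⟩ :=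
    exists_polyChain_inverseSquareTail' ℓ N hN hX1 hWc hWA hAX
  -- coefficient functions in the item's coordinate
  set C : ℕ → ℝ → ℝ := fun m x => c m (x - x₀) with hC
  have hS : IsOpen (Ioi (x₀ + X)) := isOpen_Ioi
  have hyx : ∀ {x}, x₀ + X < x → X < x - x₀ := fun {x} hx => by linarith
  have hCreg : ∀ m, 2 * m ≤ N → ContDiffOn ℝ 2 (C m) (Ioi (x₀ + X)) := by
    intro m hm
    obtain ⟨-, -, h3, -⟩ := hlev m hm
    exact h3.comp (contDiffOn_id.sub contDiffOn_const) fun x hx => hyx hx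
  have hCit : ∀ m, 2 * m ≤ N → ∀ x, x₀ + X < x →
      iteratedDeriv 2 (C m) x = iteratedDeriv 2 (c m) (x - x₀) := by
    intro m _ x _
    show iteratedDeriv 2 (fun z => c m (z - x₀)) x = iteratedDeriv 2 (c m) (x - x₀)
    rw [iteratedDeriv_comp_sub_const]
  have hCder : ∀ m, 2 * m ≤ N → ∀ x, x₀ + X < x → deriv (C m) x = c' m (x - x₀) := by
    intro m hm x hx
    obtain ⟨-, -, -, -, h5, -⟩ := hlev m hm
    show deriv (fun z => c m (z - x₀)) x = c' m (x - x₀)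
    rw [deriv_comp_sub_const, h5 _ (hyx hx)]
  have h0 : ∀ x ∈ Ioi (x₀ + X), iteratedDeriv 2 (C 0) x = V x * C 0 x := by
    intro x hx
    have hx' : x₀ + X < x := hx
    rw [hCit 0 (by omega) x hx', hode0 _ (hyx hx'), hVW _ (by linarith [hyx hx'])]
    show V (x - x₀ + x₀) * c 0 (x - x₀) = V x * c 0 (x - x₀)
    rw [sub_add_cancel]
  have hrec : ∀ m, 1 ≤ m → 2 * m ≤ N → ∀ x ∈ Ioi (x₀ + X), iteratedDeriv 2 (C m) x
      = V x * C m x + ((N : ℝ) - 2 * m + 2) * ((N : ℝ) - 2 * m + 1) * C (m - 1) x := by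
    intro m hm1 hm x hx
    have hx' : x₀ + X < x := hx
    rw [hCit m hm x hx', hode m hm1 hm _ (hyx hx'), hVW _ (by linarith [hyx hx'])]
    show V (x - x₀ + x₀) * c m (x - x₀) + _ = V x * c m (x - x₀) + _
    rw [sub_add_cancel]
  obtain ⟨p, hp, hpC2, hpsol, hprep, heven, hodd⟩ :=
    exists_tPolynomial_waveSolution hS N hCreg h0 hrec
  refine ⟨p, C, κ, K, K₂, hp, hpC2, fun t x hx => hpsol t x hx, hprep, heven, hodd, hκ0, hκ, hκne,
    fun m hm => ⟨hCreg m hm, fun x hx => ?_, fun x hx => ?_, fun x hx => ?_, fun x hx => ?_⟩⟩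
  · obtain ⟨-, -, -, -, -, h6, -⟩ := hlev m hm
    exact h6 _ (hyx hx).le
  · obtain ⟨-, -, -, -, -, -, h7, -⟩ := hlev m hm
    rw [hCder m hm x hx]
    exact h7 _ (hyx hx).le
  · obtain ⟨-, -, -, -, -, -, -, h8, -⟩ := hlev m hm
    exact h8 _ (hyx hx).le
  · obtain ⟨-, -, -, -, -, -, -, -, h9⟩ := hlev m hm
    rw [hCder m hm x hx]
    exact h9 _ (hyx hx).le

end Summit.FinalStateConjecture.FinalStateConjecture.Theorems
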